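import Summits.Ventures.LatticeQCDFlow.Scaling.HubChainPerStepDomination
import Summits.Ventures.LatticeQCDFlow.Scaling.HubClassChainDictionary

/-!
HONEST FRAMING: exact (Metropolis-corrected) sampling algorithms for lattice gauge theory; figures
of merit are autocorrelation/cost numbers at stated couplings and volumes; no continuum-physics
claim.

# HubClassGlobalDomination — CONJECTURE M′ IN CHAPTER W'S OWN LANGUAGE, RANK-FREE AND GLOBAL: FOR THE HUB KERNEL `Kh(N;h,v) = (N(v)/K)·min{1,W_h/W_v}` ON A FINITE CONTENT TYPE,
# LOWERING THE PERSISTENCE OF ONE PRESENT CONTENT `t` (ACROSS ANY NUMBER OF OTHER CONTENTS) LOWERS `Khⁿ(N;z,w)` FOR EVERY `n` AND ALL PRESENT `z ≠ w` OFF `t` (lean-2 GEN-40, ours)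

Venture-side (OURS).  Cell `lqcd-flow` (pub-lqcd), unit `pub-lqcd-lean-2-g40`, 2026-08-30.  Chapter Z, file 3.  File Z2 settled Conjecture M′ in the sorted, LOCAL form of chapter Y.
Chapter W's chains live on a finite content type `S` (`Kh(N;h,v) = 𝟙{N(h)≠0}(N(v)/K)acc(h,v)`, `acc(h,v) = min{1,W_h/W_v}`), and the two chains of an adjacent pair differ in the
persistence of ONE content `t` by an amount that may carry `t` past other contents, so that no common depth ranking exists.  Here the local theorem is globalised:
`global_exists_sorted_enum` (present contents enumerated by any real key), `global_sorted_of_key` (if NO present content lies strictly between `W^Y_t` and `W^X_t`, the key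
`W^X + W^Y` sorts BOTH profiles), `global_domination_of_enum` (common sorted enumeration + Y12's dictionary `dict_Khn_offdiag` + Z2's `perStep_T_le`; the particle condition holds
because `z, w, t` are three distinct present contents and `Σ_vN(v) ≤ K+1`), and **`hubClass_global_domination`**: for ANY two persistence profiles `W^X, W^Y > 0` agreeing off `t`
with `W^Y_t ≤ W^X_t` (`t` DEEPER in `Y`), any composition `N` with `N(t) ≠ 0`, `Σ_vN(v) ≤ K+1`, the hub kernels of the two profiles (hypothesis-equations as in chapter W) and their
`n`-step kernels: **`Kh_Yⁿ(N;z,w) ≤ Kh_Xⁿ(N;z,w)` for every `n` and all present `z ≠ w` off `t`** — by induction on the number of present contents strictly between `W^Y_t` and `W^X_t`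
(an intermediate profile with `t` tied to one of them splits the move into two shorter ones; the inequality is transitive).  This is the per-step form of Conjecture D (MEMO-gen37 §4)
off the start content, for a class `t` of any weight; at `w = z` it is false (Y5) and the discounted form W20 ∕ W26 takes over.  TOY (`numerics/toy5.py`, exact rationals, NOTHING
CLAIMED): 0 violations in ≈ 96 000 crossing checks.  Literature grade (cell rule): OWN; nothing cited; no new bib keys.
-/

open Finset

namespace Summit.Ventures.LatticeQCDFlow.Scaling

section GlobalDom
variable {S : Type*} [Fintype S] [DecidableEq S]

/-! ### §1 Sorted enumerations of the contents present -/

/-- **Every composition's present contents admit an enumeration sorted by a real key** (non-increasing), injective and covering. [ours] -/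
theorem global_exists_sorted_enum (N : S → ℕ) (f : S → ℝ) (d : S) :
    ∃ (m : ℕ) (e : ℕ → S), (∀ i j, i < m → j < m → e i = e j → i = j) ∧ (∀ i, i < m → N (e i) ≠ 0) ∧
      (∀ v, N v ≠ 0 → ∃ i, i < m ∧ e i = v) ∧ (∀ i j, i ≤ j → j < m → f (e j) ≤ f (e i)) := by
  classical
  have key : ∀ (k : ℕ) (A : Finset S), A.card = k → ∃ (m : ℕ) (e : ℕ → S), (∀ i j, i < m → j < m → e i = e j → i = j) ∧ (∀ i, i < m → e i ∈ A) ∧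
      (∀ v, v ∈ A → ∃ i, i < m ∧ e i = v) ∧ (∀ i j, i ≤ j → j < m → f (e j) ≤ f (e i)) := by
    intro k
    induction k with
    | zero =>
        intro A hA
        rw [Finset.card_eq_zero] at hA
        subst hA
        exact ⟨0, fun _ => d, fun i j hi => absurd hi (Nat.not_lt_zero i), fun i hi => absurd hi (Nat.not_lt_zero i),
          fun v hv => absurd hv (Finset.notMem_empty v), fun i j _ hj => absurd hj (Nat.not_lt_zero j)⟩
    | succ k ih =>
        intro A hA
        have hne : A.Nonempty := by rw [← Finset.card_pos, hA]; omega
        obtain ⟨a, ha, hmax⟩ := Finset.exists_max_image A f hne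
        obtain ⟨m, e, hinj, hmem, hcov, hsort⟩ := ih (A.erase a) (by rw [Finset.card_erase_of_mem ha, hA]; omega)
        have has : a ∉ A.erase a := fun h => (Finset.mem_erase.mp h).1 rfl
        refine ⟨m + 1, fun i => if i = 0 then a else e (i - 1), ?_, ?_, ?_, ?_⟩
        · intro i j hi hj hij
          by_cases hi0 : i = 0
          · by_cases hj0 : j = 0
            · rw [hi0, hj0]
            · simp only [hi0, if_true, hj0, if_false] at hij
              exact absurd (hij ▸ hmem (j - 1) (by omega)) has
          · by_cases hj0 : j = 0
            · simp only [hi0, if_false, hj0, if_true] at hij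
              exact absurd (hij.symm ▸ hmem (i - 1) (by omega)) has
            · simp only [hi0, if_false, hj0] at hij
              have := hinj (i - 1) (j - 1) (by omega) (by omega) hij
              omega
        · intro i hi
          by_cases hi0 : i = 0
          · simp only [hi0, if_true]; exact ha
          · simp only [hi0, if_false]; exact Finset.mem_of_mem_erase (hmem (i - 1) (by omega))
        · intro v hv
          by_cases hva : v = a
          · exact ⟨0, by omega, by simp [hva]⟩
          · obtain ⟨i, hi, rfl⟩ := hcov v (Finset.mem_erase.mpr ⟨hva, hv⟩)
            exact ⟨i + 1, by omega, by simp⟩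
        · intro i j hij hj
          by_cases hj0 : j = 0
          · have hi0 : i = 0 := by omega
            simp [hi0, hj0]
          · by_cases hi0 : i = 0
            · simp only [hj0, if_false, hi0, if_true]
              exact hmax _ (Finset.mem_of_mem_erase (hmem (j - 1) (by omega)))
            · simp only [hj0, if_false, hi0]
              exact hsort (i - 1) (j - 1) (by omega) (by omega)
  obtain ⟨m, e, hinj, hmem, hcov, hsort⟩ := key _ (univ.filter fun v => N v ≠ 0) rfl
  refine ⟨m, e, hinj, fun i hi => (mem_filter.mp (hmem i hi)).2, fun v hv => hcov v (mem_filter.mpr ⟨mem_univ v, hv⟩), hsort⟩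

omit [Fintype S] in
/-- **When no present content has its persistence strictly between `W^Y_t` and `W^X_t`, an enumeration sorted by the key `W^X + W^Y` is sorted for both profiles.** [ours] -/
theorem global_sorted_of_key {WX WY : S → ℝ} {t : S} {N : S → ℕ} {e : ℕ → S} {m : ℕ}
    (hagree : ∀ v, v ≠ t → WX v = WY v) (hWt : WY t ≤ WX t)
    (hnone : ∀ v, N v ≠ 0 → v ≠ t → ¬ (WY t < WX v ∧ WX v < WX t))
    (he_inj : ∀ i j, i < m → j < m → e i = e j → i = j) (he_pres : ∀ i, i < m → N (e i) ≠ 0)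
    (hkey : ∀ i j, i ≤ j → j < m → WX (e j) + WY (e j) ≤ WX (e i) + WY (e i)) :
    (∀ i j, i ≤ j → j < m → WX (e j) ≤ WX (e i)) ∧ (∀ i j, i ≤ j → j < m → WY (e j) ≤ WY (e i)) := by
  have main : ∀ i j, i ≤ j → j < m → WX (e j) ≤ WX (e i) ∧ WY (e j) ≤ WY (e i) := by
    intro i j hij hj
    have hk := hkey i j hij hj
    by_cases hi : e i = t
    · by_cases hj' : e j = t
      · have : i = j := he_inj i j (by omega) hj (by rw [hi, hj'])
        subst this; exact ⟨le_rfl, le_rfl⟩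
      · have hw := hagree (e j) hj'
        have hn := hnone (e j) (he_pres j hj) hj'
        rw [hi]; rw [hi] at hk
        by_cases hc : WX (e j) ≤ WY t
        · constructor <;> linarith
        · exfalso
          have hc' : WY t < WX (e j) := not_le.mp hc
          have : WX t ≤ WX (e j) := by
            by_contra h'; exact hn ⟨hc', not_le.mp h'⟩
          linarith
    · by_cases hj' : e j = t
      · have hw := hagree (e i) hi
        have hn := hnone (e i) (he_pres i (by omega)) hi
        rw [hj']; rw [hj'] at hk
        by_cases hc : WX t ≤ WX (e i)
        · constructor <;> linarith
        · exfalso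
          have hc' : WX (e i) < WX t := not_le.mp hc
          have : WX (e i) ≤ WY t := by
            by_contra h'; exact hn ⟨not_le.mp h', hc'⟩
          linarith
      · have hwi := hagree (e i) hi
        have hwj := hagree (e j) hj'
        constructor <;> linarith
  exact ⟨fun i j hij hj => (main i j hij hj).1, fun i j hij hj => (main i j hij hj).2⟩

/-! ### §2 Domination given a common sorted enumeration -/

/-- **Local → global, step 1:** with a common enumeration of the present contents sorted for BOTH profiles, per-step domination off the moved content `t` follows from Y12's dictionary
and Z2's `perStep_T_le`. [ours] -/
theorem global_domination_of_enum {WX WY : S → ℝ} {accX accY : S → S → ℝ} {KhX KhY : (S → ℕ) → S → S → ℝ} {K : ℕ} {N : S → ℕ} {t : S}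
    {KhnX KhnY : ℕ → S → S → ℝ} {e : ℕ → S} {m : ℕ}
    (hWX : ∀ v, 0 < WX v) (hWY : ∀ v, 0 < WY v) (hagree : ∀ v, v ≠ t → WX v = WY v) (hWt : WY t ≤ WX t)
    (haccX : ∀ h v, accX h v = min 1 (WX h / WX v)) (haccY : ∀ h v, accY h v = min 1 (WY h / WY v)) (hK : 1 ≤ K)
    (hNK : ∑ v, (N v : ℝ) ≤ K + 1) (hNt : N t ≠ 0)
    (hKXoff : ∀ N' h v, h ≠ v → KhX N' h v = if N' h = 0 then 0 else (N' v : ℝ) / K * accX h v)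
    (hKXdiag : ∀ N' h, KhX N' h h = 1 - ∑ v ∈ univ.erase h, KhX N' h v)
    (hKYoff : ∀ N' h v, h ≠ v → KhY N' h v = if N' h = 0 then 0 else (N' v : ℝ) / K * accY h v)
    (hKYdiag : ∀ N' h, KhY N' h h = 1 - ∑ v ∈ univ.erase h, KhY N' h v)
    (hKhnX0 : ∀ h v, KhnX 0 h v = if h = v then 1 else 0) (hKhnXs : ∀ n h v, KhnX (n + 1) h v = ∑ w, KhnX n h w * KhX N w v)
    (hKhnY0 : ∀ h v, KhnY 0 h v = if h = v then 1 else 0) (hKhnYs : ∀ n h v, KhnY (n + 1) h v = ∑ w, KhnY n h w * KhY N w v)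
    (he_inj : ∀ i j, i < m → j < m → e i = e j → i = j) (he_pres : ∀ i, i < m → N (e i) ≠ 0) (he_cov : ∀ v, N v ≠ 0 → ∃ i, i < m ∧ e i = v)
    (hsortX : ∀ i j, i ≤ j → j < m → WX (e j) ≤ WX (e i)) (hsortY : ∀ i j, i ≤ j → j < m → WY (e j) ≤ WY (e i))
    (n : ℕ) {z w : S} (hzw : z ≠ w) (hzt : z ≠ t) (hwt : w ≠ t) (hz : N z ≠ 0) (hw : N w ≠ 0) :
    KhnY n z w ≤ KhnX n z w := by
  obtain ⟨i, hi, rfl⟩ := he_cov z hz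
  obtain ⟨j, hj, rfl⟩ := he_cov w hw
  obtain ⟨s, hs, hst⟩ := he_cov t hNt
  have hij : i ≠ j := fun h => hzw (by rw [h])
  have his : i ≠ s := fun h => hzt (by rw [h, hst])
  have hjs : j ≠ s := fun h => hwt (by rw [h, hst])
  have hm : 1 ≤ m := by omega
  have hWXY : ∀ v, WY v ≤ WX v := fun v => by
    by_cases hv : v = t
    · rw [hv]; exact hWt
    · rw [hagree v hv]
  have het : ∀ l, l < m → l ≠ s → e l ≠ t := fun l hl hls h => hls (he_inj l s hl hs (by rw [h, hst]))
  -- the `ℕ`-indexed data of chapter Y for the two profiles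
  obtain ⟨c, hc⟩ : ∃ c : ℝ, c = 1 / K := ⟨_, rfl⟩
  obtain ⟨ρX, hρX⟩ : ∃ ρX : ℕ → ℝ, ∀ l, ρX l = if l < m then 1 / WX (e l) else 1 / WY (e (m - 1)) := ⟨_, fun _ => rfl⟩
  obtain ⟨ρY, hρY⟩ : ∃ ρY : ℕ → ℝ, ∀ l, ρY l = if l < m then 1 / WY (e l) else 1 / WY (e (m - 1)) := ⟨_, fun _ => rfl⟩
  obtain ⟨Nn, hNn⟩ : ∃ Nn : ℕ → ℝ, ∀ l, Nn l = if l < m then (N (e l) : ℝ) else 1 := ⟨_, fun _ => rfl⟩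
  obtain ⟨RX, hRX⟩ : ∃ RX : ℕ → ℝ, ∀ k, RX k = ∑ i ∈ range k, Nn i * ρX i := ⟨_, fun _ => rfl⟩
  obtain ⟨RY, hRY⟩ : ∃ RY : ℕ → ℝ, ∀ k, RY k = ∑ i ∈ range k, Nn i * ρY i := ⟨_, fun _ => rfl⟩
  obtain ⟨M, hM⟩ : ∃ M : ℕ → ℝ, ∀ k, M k = ∑ i ∈ Ico k m, Nn i := ⟨_, fun _ => rfl⟩
  obtain ⟨βX, hβX⟩ : ∃ βX : ℕ → ℝ, ∀ k, βX k = 1 - c * (M k + RX k / ρX k) := ⟨_, fun _ => rfl⟩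
  obtain ⟨βY, hβY⟩ : ∃ βY : ℕ → ℝ, ∀ k, βY k = 1 - c * (M k + RY k / ρY k) := ⟨_, fun _ => rfl⟩
  obtain ⟨a, ha⟩ : ∃ a : ℕ → ℝ, ∀ l, a l = 1 - c * M (l + 1) := ⟨_, fun _ => rfl⟩
  obtain ⟨TX, hTX⟩ : ∃ TX : ℕ → ℕ → ℝ, ∀ n j, TX n j = (1 - βX j ^ n) / RX m + ∑ k ∈ Ico (j + 1) m, (1 / RX k - 1 / RX (k + 1)) * (βX k ^ n - βX j ^ n) :=
    ⟨_, fun _ _ => rfl⟩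
  obtain ⟨TY, hTY⟩ : ∃ TY : ℕ → ℕ → ℝ, ∀ n j, TY n j = (1 - βY j ^ n) / RY m + ∑ k ∈ Ico (j + 1) m, (1 / RY k - 1 / RY (k + 1)) * (βY k ^ n - βY j ^ n) :=
    ⟨_, fun _ _ => rfl⟩
  -- elementary facts about the data
  have hρXpos : ∀ l, 0 < ρX l := fun l => by rw [hρX]; split_ifs <;> exact one_div_pos.mpr (by first | exact hWX _ | exact hWY _)
  have hρYpos : ∀ l, 0 < ρY l := fun l => by rw [hρY]; split_ifs <;> exact one_div_pos.mpr (hWY _)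
  have hNnpos : ∀ l, 0 < Nn l := fun l => by
    rw [hNn]; split_ifs with h
    · exact_mod_cast Nat.pos_of_ne_zero (he_pres l h)
    · exact one_pos
  have hmonoX : Monotone ρX := by
    intro l l' hll'
    rw [hρX, hρX]
    by_cases hl' : l' < m
    · rw [if_pos hl', if_pos (by omega : l < m)]
      exact one_div_le_one_div_of_le (hWX _) (hsortX l l' hll' hl')
    · rw [if_neg hl']
      by_cases hl : l < m
      · rw [if_pos hl]
        exact one_div_le_one_div_of_le (hWY _) ((hWXY _).trans (hsortX l (m - 1) (by omega) (by omega)))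
      · rw [if_neg hl]
  have hmonoY : Monotone ρY := by
    intro l l' hll'
    rw [hρY, hρY]
    by_cases hl' : l' < m
    · rw [if_pos hl', if_pos (by omega : l < m)]
      exact one_div_le_one_div_of_le (hWY _) (hsortY l l' hll' hl')
    · rw [if_neg hl']
      by_cases hl : l < m
      · rw [if_pos hl]
        exact one_div_le_one_div_of_le (hWY _) (hsortY l (m - 1) (by omega) (by omega))
      · rw [if_neg hl]
  have hagree' : ∀ l, l ≠ s → ρX l = ρY l := by
    intro l hls
    rw [hρX, hρY]
    by_cases hl : l < m
    · rw [if_pos hl, if_pos hl, hagree (e l) (het l hl hls)]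
    · rw [if_neg hl, if_neg hl]
  have htag' : ρX s ≤ ρY s := by
    rw [hρX, hρY, if_pos hs, if_pos hs, hst]
    exact one_div_le_one_div_of_le (hWY t) hWt
  have hc0 : 0 ≤ c := by rw [hc]; positivity
  -- `M_0 = Σ_v N(v) ≤ K+1`
  have hM0 : M 0 = ∑ v, (N v : ℝ) := by
    rw [hM, dict_sum_present he_inj he_cov (F := fun v => (N v : ℝ)) (fun v hv => by simp [hv])]
    refine sum_congr (by ext l; simp) fun l hl => ?_
    rw [hNn, if_pos (mem_range.mp hl)]
  have hKpos : (0 : ℝ) < K := by exact_mod_cast hK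
  have hcK : c * M 0 ≤ 1 + c := by
    rw [hM0, hc]
    rw [div_mul_eq_mul_div, one_mul, div_le_iff₀ hKpos]
    have : (1 + 1 / (K : ℝ)) * K = K + 1 := by field_simp
    rw [this]; exact hNK
  -- three particles at ranks `≤ max(i,j,s)`
  have h3 : M (max (max i j) s + 1) + 3 ≤ M 0 := by
    have hk : max (max i j) s < m := max_lt (max_lt hi hj) hs
    have hsplit : M 0 = ∑ l ∈ range (max (max i j) s + 1), Nn l + M (max (max i j) s + 1) := by
      rw [hM, hM, ← Finset.range_eq_Ico]
      exact (Finset.sum_range_add_sum_Ico _ (by omega : max (max i j) s + 1 ≤ m)).symm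
    have hsub : ({i, j, s} : Finset ℕ) ⊆ range (max (max i j) s + 1) := by
      intro x hx
      simp only [mem_insert, mem_singleton] at hx
      rcases hx with rfl | rfl | rfl
      · exact mem_range.mpr (Nat.lt_succ_of_le ((le_max_left _ _).trans (le_max_left _ _)))
      · exact mem_range.mpr (Nat.lt_succ_of_le ((le_max_right _ _).trans (le_max_left _ _)))
      · exact mem_range.mpr (Nat.lt_succ_of_le (le_max_right _ _))
    have hge : Nn i + Nn j + Nn s ≤ ∑ l ∈ range (max (max i j) s + 1), Nn l := by
      have h := sum_le_sum_of_subset_of_nonneg hsub (fun l _ _ => (hNnpos l).le)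
      rw [sum_insert (by simp [hij, his]), sum_insert (by simp [hjs]), sum_singleton] at h
      linarith
    have hone : ∀ l, l < m → 1 ≤ Nn l := fun l hl => by
      rw [hNn, if_pos hl]; exact_mod_cast Nat.one_le_iff_ne_zero.mpr (he_pres l hl)
    linarith [hone i hi, hone j hj, hone s hs]
  -- the dictionary of Y12 for the two profiles
  have hRdict : ∀ {W : S → ℝ} {ρ R : ℕ → ℝ}, (∀ l, ρ l = if l < m then 1 / W (e l) else 1 / WY (e (m - 1))) → (∀ k, R k = ∑ i ∈ range k, Nn i * ρ i) →
      ∀ k, k ≤ m → R k = ∑ l ∈ range k, (N (e l) : ℝ) / W (e l) := by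
    intro W ρ R hρ hR k hk
    rw [hR]
    refine sum_congr rfl fun l hl => ?_
    have hl' : l < m := by have := mem_range.mp hl; omega
    rw [hNn, hρ, if_pos hl', if_pos hl']; ring
  have hMdict : ∀ k, k ≤ m → M k = ∑ l ∈ Ico k m, (N (e l) : ℝ) := fun k _ => by
    rw [hM]; exact sum_congr rfl fun l hl => by rw [hNn, if_pos (mem_Ico.mp hl).2]
  have hβdict : ∀ {W : S → ℝ} {ρ R β : ℕ → ℝ}, (∀ v, 0 < W v) → (∀ l, ρ l = if l < m then 1 / W (e l) else 1 / WY (e (m - 1))) →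
      (∀ k, β k = 1 - c * (M k + R k / ρ k)) → ∀ k, k < m → β k = 1 - 1 / K * (M k + R k * W (e k)) := by
    intro W ρ R β hW hρ hβ k hk
    rw [hβ, hρ, if_pos hk, hc]
    have := (hW (e k)).ne'
    congr 2
    field_simp
  have hdX := dict_Khn_offdiag hWX haccX hK hKXoff hKXdiag he_inj he_pres he_cov hsortX hKhnX0 hKhnXs (R := RX) (M := M) (β := βX) (T := TX)
    (hRdict hρX hRX) hMdict (hβdict hWX hρX hβX) (fun n j _ => hTX n j) n hi hj hij
  have hdY := dict_Khn_offdiag hWY haccY hK hKYoff hKYdiag he_inj he_pres he_cov hsortY hKhnY0 hKhnYs (R := RY) (M := M) (β := βY) (T := TY)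
    (hRdict hρY hRY) hMdict (hβdict hWY hρY hβY) (fun n j _ => hTY n j) n hi hj hij
  rw [hdX, hdY, ← hagree (e j) (het j hj hjs)]
  have hms : max i j ≠ s := by
    rcases le_total i j with h | h
    · rwa [max_eq_right h]
    · rwa [max_eq_left h]
  have hT := perStep_T_le hρXpos hmonoX hρYpos hmonoY hagree' htag' hNnpos hRX hRY hM hβX hβY ha hTX hTY hc0 hcK n hms (max_lt hi hj) hs h3
  exact mul_le_mul_of_nonneg_left hT (div_nonneg (Nat.cast_nonneg _) (hWX _).le)

/-- **Local → global, step 2 (the base of the induction):** if no present content lies strictly between the two persistences of `t`, domination holds. [ours] -/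
theorem global_domination_base {WX WY : S → ℝ} {accX accY : S → S → ℝ} {KhX KhY : (S → ℕ) → S → S → ℝ} {K : ℕ} {N : S → ℕ} {t : S}
    {KhnX KhnY : ℕ → S → S → ℝ}
    (hWX : ∀ v, 0 < WX v) (hWY : ∀ v, 0 < WY v) (hagree : ∀ v, v ≠ t → WX v = WY v) (hWt : WY t ≤ WX t)
    (haccX : ∀ h v, accX h v = min 1 (WX h / WX v)) (haccY : ∀ h v, accY h v = min 1 (WY h / WY v)) (hK : 1 ≤ K)
    (hNK : ∑ v, (N v : ℝ) ≤ K + 1) (hNt : N t ≠ 0)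
    (hKXoff : ∀ N' h v, h ≠ v → KhX N' h v = if N' h = 0 then 0 else (N' v : ℝ) / K * accX h v)
    (hKXdiag : ∀ N' h, KhX N' h h = 1 - ∑ v ∈ univ.erase h, KhX N' h v)
    (hKYoff : ∀ N' h v, h ≠ v → KhY N' h v = if N' h = 0 then 0 else (N' v : ℝ) / K * accY h v)
    (hKYdiag : ∀ N' h, KhY N' h h = 1 - ∑ v ∈ univ.erase h, KhY N' h v)
    (hKhnX0 : ∀ h v, KhnX 0 h v = if h = v then 1 else 0) (hKhnXs : ∀ n h v, KhnX (n + 1) h v = ∑ w, KhnX n h w * KhX N w v)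
    (hKhnY0 : ∀ h v, KhnY 0 h v = if h = v then 1 else 0) (hKhnYs : ∀ n h v, KhnY (n + 1) h v = ∑ w, KhnY n h w * KhY N w v)
    (hnone : ∀ v, N v ≠ 0 → v ≠ t → ¬ (WY t < WX v ∧ WX v < WX t))
    (n : ℕ) {z w : S} (hzw : z ≠ w) (hzt : z ≠ t) (hwt : w ≠ t) (hz : N z ≠ 0) (hw : N w ≠ 0) :
    KhnY n z w ≤ KhnX n z w := by
  obtain ⟨m, e, he_inj, he_pres, he_cov, hkey⟩ := global_exists_sorted_enum N (fun v => WX v + WY v) t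
  obtain ⟨hsortX, hsortY⟩ := global_sorted_of_key hagree hWt hnone he_inj he_pres hkey
  exact global_domination_of_enum hWX hWY hagree hWt haccX haccY hK hNK hNt hKXoff hKXdiag hKYoff hKYdiag hKhnX0 hKhnXs hKhnY0 hKhnYs he_inj he_pres he_cov
    hsortX hsortY n hzw hzt hwt hz hw

/-! ### §3 The global theorem: induction on the number of contents crossed -/

/-- **CONJECTURE M′, RANK-FREE AND GLOBAL (class chains on a finite content type).**  Two persistence profiles `W^X, W^Y > 0` agreeing off one content `t` with `W^Y_t ≤ W^X_t`; a
composition `N` with `N(t) ≠ 0`, `Σ_vN(v) ≤ K+1`; the hub kernels of chapter W for the two profiles and their `n`-step kernels.  Then for every `n` and all present `z ≠ w` off `t`: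
`Kh_Yⁿ(N;z,w) ≤ Kh_Xⁿ(N;z,w)`. [ours] -/
theorem hubClass_global_domination {K : ℕ} {N : S → ℕ} {t : S} (hK : 1 ≤ K) (hNK : ∑ v, (N v : ℝ) ≤ K + 1) (hNt : N t ≠ 0)
    {WX WY : S → ℝ} {accX accY : S → S → ℝ} {KhX KhY : (S → ℕ) → S → S → ℝ} {KhnX KhnY : ℕ → S → S → ℝ}
    (hWX : ∀ v, 0 < WX v) (hWY : ∀ v, 0 < WY v) (hagree : ∀ v, v ≠ t → WX v = WY v) (hWt : WY t ≤ WX t)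
    (haccX : ∀ h v, accX h v = min 1 (WX h / WX v)) (haccY : ∀ h v, accY h v = min 1 (WY h / WY v))
    (hKXoff : ∀ N' h v, h ≠ v → KhX N' h v = if N' h = 0 then 0 else (N' v : ℝ) / K * accX h v)
    (hKXdiag : ∀ N' h, KhX N' h h = 1 - ∑ v ∈ univ.erase h, KhX N' h v)
    (hKYoff : ∀ N' h v, h ≠ v → KhY N' h v = if N' h = 0 then 0 else (N' v : ℝ) / K * accY h v)
    (hKYdiag : ∀ N' h, KhY N' h h = 1 - ∑ v ∈ univ.erase h, KhY N' h v)
    (hKhnX0 : ∀ h v, KhnX 0 h v = if h = v then 1 else 0) (hKhnXs : ∀ n h v, KhnX (n + 1) h v = ∑ w, KhnX n h w * KhX N w v)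
    (hKhnY0 : ∀ h v, KhnY 0 h v = if h = v then 1 else 0) (hKhnYs : ∀ n h v, KhnY (n + 1) h v = ∑ w, KhnY n h w * KhY N w v)
    (n : ℕ) {z w : S} (hzw : z ≠ w) (hzt : z ≠ t) (hwt : w ≠ t) (hz : N z ≠ 0) (hw : N w ≠ 0) :
    KhnY n z w ≤ KhnX n z w := by
  classical
  suffices key : ∀ (B : ℕ) (WX WY : S → ℝ) (accX accY : S → S → ℝ) (KhX KhY : (S → ℕ) → S → S → ℝ) (KhnX KhnY : ℕ → S → S → ℝ),
      (univ.filter fun v => N v ≠ 0 ∧ WY t < WX v ∧ WX v < WX t).card ≤ B →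
      (∀ v, 0 < WX v) → (∀ v, 0 < WY v) → (∀ v, v ≠ t → WX v = WY v) → WY t ≤ WX t →
      (∀ h v, accX h v = min 1 (WX h / WX v)) → (∀ h v, accY h v = min 1 (WY h / WY v)) →
      (∀ N' h v, h ≠ v → KhX N' h v = if N' h = 0 then 0 else (N' v : ℝ) / K * accX h v) →
      (∀ N' h, KhX N' h h = 1 - ∑ v ∈ univ.erase h, KhX N' h v) →
      (∀ N' h v, h ≠ v → KhY N' h v = if N' h = 0 then 0 else (N' v : ℝ) / K * accY h v) →
      (∀ N' h, KhY N' h h = 1 - ∑ v ∈ univ.erase h, KhY N' h v) →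
      (∀ h v, KhnX 0 h v = if h = v then 1 else 0) → (∀ n h v, KhnX (n + 1) h v = ∑ w, KhnX n h w * KhX N w v) →
      (∀ h v, KhnY 0 h v = if h = v then 1 else 0) → (∀ n h v, KhnY (n + 1) h v = ∑ w, KhnY n h w * KhY N w v) →
      ∀ n, KhnY n z w ≤ KhnX n z w from
    key _ WX WY accX accY KhX KhY KhnX KhnY le_rfl hWX hWY hagree hWt haccX haccY hKXoff hKXdiag hKYoff hKYdiag hKhnX0 hKhnXs hKhnY0 hKhnYs n
  intro B
  induction B with
  | zero =>
      intro WX WY accX accY KhX KhY KhnX KhnY hB hWX hWY hagree hWt haccX haccY hKXoff hKXdiag hKYoff hKYdiag hKhnX0 hKhnXs hKhnY0 hKhnYs n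
      have hnone : ∀ v, N v ≠ 0 → v ≠ t → ¬ (WY t < WX v ∧ WX v < WX t) := by
        intro v hv _ hb
        have : v ∈ univ.filter fun v => N v ≠ 0 ∧ WY t < WX v ∧ WX v < WX t := mem_filter.mpr ⟨mem_univ v, hv, hb⟩
        rw [Finset.card_eq_zero.mp (Nat.le_zero.mp hB)] at this
        exact absurd this (Finset.notMem_empty v)
      exact global_domination_base hWX hWY hagree hWt haccX haccY hK hNK hNt hKXoff hKXdiag hKYoff hKYdiag hKhnX0 hKhnXs hKhnY0 hKhnYs hnone n hzw hzt hwt hz hw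
  | succ B ih =>
      intro WX WY accX accY KhX KhY KhnX KhnY hB hWX hWY hagree hWt haccX haccY hKXoff hKXdiag hKYoff hKYdiag hKhnX0 hKhnXs hKhnY0 hKhnYs n
      by_cases hempty : (univ.filter fun v => N v ≠ 0 ∧ WY t < WX v ∧ WX v < WX t) = ∅
      · have hnone : ∀ v, N v ≠ 0 → v ≠ t → ¬ (WY t < WX v ∧ WX v < WX t) := by
          intro v hv _ hb
          have : v ∈ univ.filter fun v => N v ≠ 0 ∧ WY t < WX v ∧ WX v < WX t := mem_filter.mpr ⟨mem_univ v, hv, hb⟩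
          rw [hempty] at this
          exact absurd this (Finset.notMem_empty v)
        exact global_domination_base hWX hWY hagree hWt haccX haccY hK hNK hNt hKXoff hKXdiag hKYoff hKYdiag hKhnX0 hKhnXs hKhnY0 hKhnYs hnone n hzw hzt hwt hz hw
      obtain ⟨u, hu⟩ := Finset.nonempty_iff_ne_empty.mpr hempty
      have hu' := (mem_filter.mp hu).2
      have hut : u ≠ t := fun h => by rw [h] at hu'; exact lt_irrefl _ hu'.2.2
      -- a content `u` strictly between: the intermediate profile `W^Z` (`t` moved to `W_u`), its kernel and powers; then two shorter moves
      obtain ⟨WZ, hWZ⟩ : ∃ WZ : S → ℝ, ∀ v, WZ v = if v = t then WX u else WX v := ⟨_, fun _ => rfl⟩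
      obtain ⟨accZ, haccZ⟩ : ∃ accZ : S → S → ℝ, ∀ h v, accZ h v = min 1 (WZ h / WZ v) := ⟨_, fun _ _ => rfl⟩
      obtain ⟨offZ, hoffZ⟩ : ∃ offZ : (S → ℕ) → S → S → ℝ, ∀ N' h v, offZ N' h v = if N' h = 0 then 0 else (N' v : ℝ) / K * accZ h v := ⟨_, fun _ _ _ => rfl⟩
      obtain ⟨KhZ, hKhZ⟩ : ∃ KhZ : (S → ℕ) → S → S → ℝ, ∀ N' h v, KhZ N' h v = if h = v then 1 - ∑ v' ∈ univ.erase h, offZ N' h v' else offZ N' h v :=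
        ⟨_, fun _ _ _ => rfl⟩
      let KhnZ : ℕ → S → S → ℝ := fun n => Nat.rec (motive := fun _ => S → S → ℝ) (fun h v => if h = v then 1 else 0) (fun _ prev h v => ∑ w', prev h w' * KhZ N w' v) n
      have hKhnZ0 : ∀ h v, KhnZ 0 h v = if h = v then 1 else 0 := fun _ _ => rfl
      have hKhnZs : ∀ n h v, KhnZ (n + 1) h v = ∑ w', KhnZ n h w' * KhZ N w' v := fun _ _ _ => rfl
      have hWZpos : ∀ v, 0 < WZ v := fun v => by rw [hWZ]; split_ifs <;> exact hWX _
      have hKZoff : ∀ N' h v, h ≠ v → KhZ N' h v = if N' h = 0 then 0 else (N' v : ℝ) / K * accZ h v := fun N' h v hhv => by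
        rw [hKhZ, if_neg hhv, hoffZ]
      have hKZdiag : ∀ N' h, KhZ N' h h = 1 - ∑ v ∈ univ.erase h, KhZ N' h v := fun N' h => by
        rw [hKhZ, if_pos rfl]
        congr 1
        exact sum_congr rfl fun v hv => by rw [hKhZ, if_neg (ne_of_mem_erase hv).symm]
      have hagreeXZ : ∀ v, v ≠ t → WX v = WZ v := fun v hv => by rw [hWZ, if_neg hv]
      have hagreeZY : ∀ v, v ≠ t → WZ v = WY v := fun v hv => by rw [hWZ, if_neg hv, hagree v hv]
      have hZt : WZ t = WX u := by rw [hWZ, if_pos rfl]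
      -- the two half-moves cross fewer contents
      have hBXZ : (univ.filter fun v => N v ≠ 0 ∧ WZ t < WX v ∧ WX v < WX t).card ≤ B := by
        have hsub : (univ.filter fun v => N v ≠ 0 ∧ WZ t < WX v ∧ WX v < WX t) ⊆ (univ.filter fun v => N v ≠ 0 ∧ WY t < WX v ∧ WX v < WX t).erase u := by
          intro v hv
          have hv' := (mem_filter.mp hv).2
          rw [hZt] at hv'
          refine mem_erase.mpr ⟨fun h => ?_, mem_filter.mpr ⟨mem_univ v, hv'.1, by linarith [hu'.2.1], hv'.2.2⟩⟩
          rw [h] at hv'; exact lt_irrefl _ hv'.2.1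
        have := card_le_card hsub
        rw [card_erase_of_mem hu] at this
        omega
      have hBZY : (univ.filter fun v => N v ≠ 0 ∧ WY t < WZ v ∧ WZ v < WZ t).card ≤ B := by
        have hsub : (univ.filter fun v => N v ≠ 0 ∧ WY t < WZ v ∧ WZ v < WZ t) ⊆ (univ.filter fun v => N v ≠ 0 ∧ WY t < WX v ∧ WX v < WX t).erase u := by
          intro v hv
          have hv' := (mem_filter.mp hv).2
          have hvt : v ≠ t := fun h => by rw [h] at hv'; exact lt_irrefl _ hv'.2.2
          rw [hZt, ← hagreeXZ v hvt] at hv'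
          refine mem_erase.mpr ⟨fun h => ?_, mem_filter.mpr ⟨mem_univ v, hv'.1, hv'.2.1, by linarith [hu'.2.2]⟩⟩
          rw [h] at hv'; exact lt_irrefl _ hv'.2.2
        have := card_le_card hsub
        rw [card_erase_of_mem hu] at this
        omega
      -- the two half-moves
      have h1 : KhnZ n z w ≤ KhnX n z w :=
        ih WX WZ accX accZ KhX KhZ KhnX KhnZ hBXZ hWX hWZpos hagreeXZ (by rw [hZt]; exact hu'.2.2.le) haccX haccZ hKXoff hKXdiag hKZoff hKZdiag
          hKhnX0 hKhnXs hKhnZ0 hKhnZs n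
      have h2 : KhnY n z w ≤ KhnZ n z w :=
        ih WZ WY accZ accY KhZ KhY KhnZ KhnY hBZY hWZpos hWY hagreeZY (by rw [hZt]; exact hu'.2.1.le) haccZ haccY hKZoff hKZdiag hKYoff hKYdiag
          hKhnZ0 hKhnZs hKhnY0 hKhnYs n
      exact h2.trans h1

end GlobalDom

end Summit.Ventures.LatticeQCDFlow.Scaling
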